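/-
Copyright: statement-level skeleton of a published paper (lit-balaban cell, Phase-2 proof seat p25, gen 18). No proof
claims beyond what the kernel checks below.
-/
import Literature.MathematicalPhysics.QuantumFieldTheory.BalabanImbrieJaffe1984to88.BIJ88WalkBlockActivityLoc312
import Literature.Probability.LatticeModels.HardCoreUrsell

/-!
# `BalabanImbrieJaffe1984to88.BIJ88WalkResummationDisplay312` — T. Bałaban, J. Imbrie, A. Jaffe, *Effective action and
cluster properties of the abelian Higgs model*, Commun. Math. Phys. **114** (1988) 257–315 [BalabanImbrieJaffe1988],
§5.14 p. 312 [PDF 56], verbatim (first display):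
*"⟨Π_i F_{k,loc}(X_{σ_i})⟩ = Σ_{{X_r}} ⟨Π_c F^L_{k+1,loc}(X_c) Π_r F_{k,rem}(X_r)⟩ = Σ_{{X_r}} Π_c F^L_{k+1,loc}(X_c) ⟨Π_r F_{k,rem}(X_r)⟩"*,
*"We can arrange the construction so that the {X_c} are determined once the remainder components are specified.
Summing all possible diagrams in X_c gives
the observable for the next step there, F^L_{k+1,loc}(X_c)"* — **THE CONSTANT PART OF THE COVARIANCE-SPLIT EXPANSION
AS A GAS OF BLOCKS LOCALIZED AT CUBE SETS** (p25 gen 18): the constant part `cst C` of `BIJ88WalkResummation312`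
organises into constant components — `cst C = Σ_{O ⊆ C∖i} fl(i, (C∖i)∖O)·cst O` (`cst_eq_sum_fl`, `i` the least
observable), hence `cst C = Σ_{π ∈ set partitions of C} Π_{P ∈ π} flBlock P` (`cst_eq_sum_setPartitions`) — and every
block is the sum over the cube sets `X` of its localized activities, `flBlock P = Σ_X flAt(min P, P∖min P, X)`
(`flBlock_eq_sum_flAt`), each bounded in the printed currency by `BIJ88WalkBlockActivity312.flAbsAt_le`.  This is
print's `Π_c F^L_{k+1,loc}(X_c)`: a polymer gas of constant components, each a set of observables `P` localized at an
`R`-connected cube set `X`.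

statement-level skeleton of published theorems with citation tags; proofs where landed; nothing here is a claim
about the Yang–Mills mass gap

PDF held: `paper:balaban1988-cmp114-bij-abelian-higgs-effective-action` (journal page = PDF page + 256); p. 312 =
PDF 56 (`p0056.txt` L1–25 re-read 2026-08-22; L2–4 re-read for the docfix of the second quotation — the gen-18 header had
shortened its first sentence inside quotation marks (r16 v2.249 / ref-5 D-g64-2 class) — 2026-08-23; declarations
untouched).

CITATION HEADER (lean-in-tree rule).  lit-balaban cell (HOME `run/shared/lean/pub/lit-balaban/`), Phase 2, seat p25
gen 18; row **C2.Claim@312** of `HOME/lit-balaban-r16/ROWS-C2-part2.md` (owner r16, referee ref-5; head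
`BIJ88Sect5StatementsPart4.Ineq312` untouched — MEMBER of the row).  The labelled-lane displays are
`BIJ88Resummation312Display` (p25 gen 17); this file is their covariance-split form.  USED BY NAME, nothing restated:
`BIJ88WalkResummation312.{cst, fl, cst_step}`, `BIJ88WalkRunEnv311.{run_rest_subset, run_filter_env}`,
`BIJ88WalkExpansion311.expand_of_not_nonempty`, `BIJ88WalkBlockActivity312.flAt`,
`BIJ88WalkBlockActivityLoc312.sum_flAt_eq_fl` (this seat and generation), `BIJ88Resummation312.{sum_map_fiber,
min'_eq_of_subset, sdiff_erase_eq_erase_sdiff}` (p25 gen 17), `LatticeModels.{setPartitions,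
sum_setPartitions_eq_sum_block}`.

## What is proved (0 `sorry`, standard axioms, no new `Prop` facts; one definition with body: `flBlock`)

* §1 **`cst_eq_sum_fl`**, `flBlock`, **`cst_eq_sum_setPartitions`**.
* §2 **`flBlock_eq_sum_flAt`** (every block is the sum of its activities localized at cube sets).
HONEST SCOPE: (a) identities only (the bounds are `BIJ88WalkBlockActivity312`/`…Loc312`/`BIJ88WalkBlockNorm312`);
(b) contraction-graph components; (c) the remainder part `remv` is not decomposed here; (d) no `Ineq312` binder.
NOT summit progress; NOT continuum; NOT Clay.  Imports `BIJ88WalkBlockActivityLoc312`, `LatticeModels.HardCoreUrsell`;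
modifies nothing.
-/

noncomputable section

namespace Literature.MathematicalPhysics.QuantumFieldTheory.BalabanImbrieJaffe1984to88.BIJ88WalkResummationDisplay312

open Classical Matrix Finset
open scoped BigOperators
open Literature.Probability.LatticeModels (setPartitions setPartitions_empty mem_setPartitions
  sum_setPartitions_eq_sum_block)
open BIJ88Resummation312 (sum_map_fiber min'_eq_of_subset sdiff_erase_eq_erase_sdiff)
open BIJ88WalkRun311 BIJ88WalkRunEnv311 BIJ88WalkExpansion311 BIJ88WalkGeometry311 BIJ88WalkResummation312
  BIJ88WalkBlockActivity312 BIJ88WalkBlockActivityLoc312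

variable {S : Type} [Fintype S] {ι : Type} [Fintype ι] {κ : Type} [LinearOrder κ] {P : Type} [Fintype P]

variable {Cov : P → Matrix S S ℝ} {trig : P → Bool} {f : S → ℝ} {c : ι → ℝ} {legs : ι → List (S → ℝ)}
  {obs : κ → List (S → ℝ)} {M : ℕ}

/-! ## §1  The constant part organised into constant components -/

/-- **THE CONSTANT PART ORGANISED INTO CONSTANT COMPONENTS**: for `C` non-empty with least observable `i` and
`E = C ∖ i`, `cst C = Σ_{O ⊆ E} fl(i, E ∖ O) · cst O` — the component of `i` is ONE constant component `F^L` on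
`{i} ∪ (E ∖ O)`, the observables `O` organise into constant components on their own.
[cite: BalabanImbrieJaffe1988, §5.14 p.312] -/
theorem cst_eq_sum_fl {C : Finset κ} (h : C.Nonempty) :
    cst Cov trig f c legs obs M C
      = ∑ O ∈ (C.erase (C.min' h)).powerset,
          fl Cov trig f c legs obs M (C.min' h) (C.erase (C.min' h) \ O) * cst Cov trig f c legs obs M O := by
  obtain ⟨E, hE⟩ : ∃ E, E = C.erase (C.min' h) := ⟨_, rfl⟩
  obtain ⟨X, hX⟩ : ∃ X, X = (run Cov trig f c legs obs M (pristine obs (C.min' h)) E 0).filter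
    fun o => o.g.IsConst M := ⟨_, rfl⟩
  rw [cst_step h, ← hE, ← hX]
  -- group the constant outcomes by the observables they leave untouched
  rw [sum_map_fiber (fun o : WOut S κ ι P => o.rest) (fun o => o.a * cst Cov trig f c legs obs M o.rest) E.powerset X
    (fun o ho => Finset.mem_powerset.2 (run_rest_subset _ _ _ o (by rw [hX] at ho; exact Multiset.mem_of_mem_filter ho)))]
  refine Finset.sum_congr rfl fun O hO => ?_
  have hO' := Finset.mem_powerset.1 hO
  have e1 : ((X.filter fun o => o.rest = O).map fun o => o.a * cst Cov trig f c legs obs M o.rest).sum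
      = ((X.filter fun o => o.rest = O).map fun o => o.a).sum * cst Cov trig f c legs obs M O := by
    rw [← Multiset.sum_map_mul_right]
    refine congrArg _ (Multiset.map_congr rfl fun o ho => ?_)
    rw [(Multiset.mem_filter.1 ho).2]
  rw [e1]
  congr 1
  -- the fibre is the set of constant runs in the environment `E ∖ O` that absorb all of it
  rw [fl, hX, Multiset.filter_filter]
  have e2 : (run Cov trig f c legs obs M (pristine obs (C.min' h)) E 0).filter (fun o => o.rest = O ∧ o.g.IsConst M)
      = ((run Cov trig f c legs obs M (pristine obs (C.min' h)) E 0).filter fun o => E \ (E \ O) ⊆ o.rest).filter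
          fun o => o.g.IsConst M ∧ o.rest = O := by
    rw [Multiset.filter_filter]
    refine Multiset.filter_congr fun o _ => ?_
    rw [Finset.sdiff_sdiff_eq_self hO']
    constructor
    · rintro ⟨h1, h2⟩; exact ⟨⟨h2, h1⟩, h1.ge⟩
    · rintro ⟨⟨h2, h1⟩, _⟩; exact ⟨h1, h2⟩
  rw [e2, run_filter_env _ _ _ _ (Nat.lt_succ_self _) (E \ O) Finset.sdiff_subset, Multiset.filter_map,
    Multiset.map_map]
  have e3 : ((run Cov trig f c legs obs M (pristine obs (C.min' h)) (E \ O) 0).filter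
        ((fun o => o.g.IsConst M ∧ o.rest = O) ∘ fun o : WOut S κ ι P => { o with rest := o.rest ∪ (E \ (E \ O)) }))
      = (run Cov trig f c legs obs M (pristine obs (C.min' h)) (E \ O) 0).filter fun o => o.g.IsConst M ∧ o.rest = ∅ := by
    refine Multiset.filter_congr fun o ho => ?_
    have hr : o.rest ⊆ E \ O := run_rest_subset _ _ _ o ho
    have hd : Disjoint o.rest O := Finset.disjoint_of_subset_left hr Finset.sdiff_disjoint
    simp only [Function.comp_apply, Finset.sdiff_sdiff_eq_self hO']
    constructor
    · rintro ⟨h1, h2⟩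
      refine ⟨h1, Finset.eq_empty_of_forall_notMem fun x hx => ?_⟩
      have hxO : x ∈ O := h2 ▸ Finset.mem_union_left _ hx
      exact Finset.disjoint_left.1 hd hx hxO
    · rintro ⟨h1, h2⟩
      exact ⟨h1, by rw [h2, Finset.empty_union]⟩
  rw [e3]
  rfl

/-- **`F^L` of a block**: for a non-empty set `P` of observables, the constant component in which the least
observable of `P` absorbs exactly the others (all connected constant diagrams on `P`, with the covariance split);
`1` on the empty block (which never occurs). [cite: BalabanImbrieJaffe1988, §5.14 p.312] -/
def flBlock (Cov : P → Matrix S S ℝ) (trig : P → Bool) (f : S → ℝ) (c : ι → ℝ) (legs : ι → List (S → ℝ))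
    (obs : κ → List (S → ℝ)) (M : ℕ) (Q : Finset κ) : ℝ :=
  if h : Q.Nonempty then fl Cov trig f c legs obs M (Q.min' h) (Q.erase (Q.min' h)) else 1

/-- **`Σ_{{X_c}} Π_c F^L(X_c)`**: the constant part is the sum over the constant-component structures (set partitions of
the observables) of the product of the components' `F^L`: `cst C = Σ_{π ∈ setPartitions C} Π_{P ∈ π} flBlock P`.
[cite: BalabanImbrieJaffe1988, §5.14 p.312] -/
theorem cst_eq_sum_setPartitions : ∀ (n : ℕ) (C : Finset κ), C.card < n →
    cst Cov trig f c legs obs M C = ∑ π ∈ setPartitions C, ∏ Q ∈ π, flBlock Cov trig f c legs obs M Q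
  | 0, _, hn => absurd hn (Nat.not_lt_zero _)
  | n + 1, C, hn => by
    by_cases h : C.Nonempty
    swap
    · rw [Finset.not_nonempty_iff_eq_empty.1 h, setPartitions_empty, Finset.sum_singleton, Finset.prod_empty, cst,
        expand_of_not_nonempty Cov trig f c legs obs M Finset.not_nonempty_empty, Multiset.filter_singleton, if_pos rfl]
      simp
    have hi := C.min'_mem h
    rw [cst_eq_sum_fl h, sum_setPartitions_eq_sum_block hi]
    refine Finset.sum_nbij' (fun O => C \ O) (fun P₀ => C \ P₀) ?_ ?_ ?_ ?_ ?_
    · intro O hO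
      have hO := Finset.mem_powerset.1 hO
      refine Finset.mem_filter.2 ⟨Finset.mem_powerset.2 Finset.sdiff_subset, Finset.mem_sdiff.2 ⟨hi, fun h' => ?_⟩⟩
      exact Finset.notMem_erase _ _ (hO h')
    · intro P₀ hP₀
      obtain ⟨-, hiP⟩ := Finset.mem_filter.1 hP₀
      refine Finset.mem_powerset.2 fun x hx => Finset.mem_erase.2 ⟨?_, (Finset.mem_sdiff.1 hx).1⟩
      rintro rfl
      exact (Finset.mem_sdiff.1 hx).2 hiP
    · intro O hO
      exact Finset.sdiff_sdiff_eq_self ((Finset.mem_powerset.1 hO).trans (Finset.erase_subset _ _))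
    · intro P₀ hP₀
      exact Finset.sdiff_sdiff_eq_self (Finset.mem_powerset.1 (Finset.mem_filter.1 hP₀).1)
    · intro O hO
      have hO' := (Finset.mem_powerset.1 hO).trans (Finset.erase_subset _ _)
      have hiO : C.min' h ∈ C \ O :=
        Finset.mem_sdiff.2 ⟨hi, fun h' => Finset.notMem_erase _ _ (Finset.mem_powerset.1 hO h')⟩
      have hne : (C \ O).Nonempty := ⟨_, hiO⟩
      have hmin : (C \ O).min' hne = C.min' h := min'_eq_of_subset h Finset.sdiff_subset hiO
      have hcard : (C \ (C \ O)).card < n := by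
        rw [Finset.sdiff_sdiff_eq_self hO']
        exact lt_of_lt_of_le (lt_of_le_of_lt (Finset.card_le_card (Finset.mem_powerset.1 hO))
          (Finset.card_erase_lt_of_mem hi)) (Nat.lt_succ_iff.1 hn)
      have e : ∀ π ∈ setPartitions (C \ (C \ O)), ∏ Q ∈ insert (C \ O) π, flBlock Cov trig f c legs obs M Q
          = flBlock Cov trig f c legs obs M (C \ O) * ∏ Q ∈ π, flBlock Cov trig f c legs obs M Q := fun π hπ =>
        Finset.prod_insert ((mem_setPartitions.1 hπ).notMem_of_sdiff hne)
      rw [Finset.sum_congr rfl e, ← Finset.mul_sum, ← cst_eq_sum_setPartitions n _ hcard,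
        Finset.sdiff_sdiff_eq_self hO', flBlock, dif_pos hne, hmin, sdiff_erase_eq_erase_sdiff]

/-! ## §2  Every block is a sum of activities localized at cube sets -/

/-- **EVERY CONSTANT COMPONENT IS THE SUM OF ITS ACTIVITIES LOCALIZED AT CUBE SETS** (*"X … the union of the cubes
covering the X_{σ_i} and the regions … A connected component of X …"*): for a non-empty block `Q` with least
observable `i`, `flBlock Q = Σ_{X} flAt i (Q ∖ i) X` over the cube sets of the outcomes of the run — so that
`cst C = Σ_π Π_{Q∈π} Σ_{X_Q} flAt(min Q, Q∖min Q, X_Q)`: the constant part is a gas of blocks localized at cube sets,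
each activity bounded in the printed currency (`BIJ88WalkBlockActivity312.flAbsAt_le`).
[cite: BalabanImbrieJaffe1988, §5.14 p.311–312] -/
theorem flBlock_eq_sum_flAt {β : Type} [DecidableEq β] (oc : κ → Finset β) (vc : ι → Finset β) (reg : P → Finset β)
    {Q : Finset κ} (h : Q.Nonempty) :
    flBlock Cov trig f c legs obs M Q
      = ∑ X ∈ ((run Cov trig f c legs obs M (pristine obs (Q.min' h)) (Q.erase (Q.min' h)) 0).map
            fun o => cubes oc vc reg o.g).toFinset,
          flAt Cov trig f c legs obs M oc vc reg (Q.min' h) (Q.erase (Q.min' h)) X := by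
  rw [flBlock, dif_pos h, sum_flAt_eq_fl]

end Literature.MathematicalPhysics.QuantumFieldTheory.BalabanImbrieJaffe1984to88.BIJ88WalkResummationDisplay312

end
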